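import Literature.AlgebraicGeometry.Modules.LineBundleOfCocyclePullback
import Literature.AlgebraicGeometry.Modules.PullbackUnitComp
import HarnessLib

/-!
# `g^*(lineBundle c) ≅ lineBundle (c.pullback g)`: compatibility with composites and equal morphisms

Layer `Literature/AlgebraicGeometry/Modules`; namespace `Literature.AlgebraicGeometry.Modules.UnitCocycle`.
THEOREMS ONLY; sequel of `Modules/LineBundleOfCocyclePullback.lean` (`pullbackHom`, `pullbackLineBundleIso`,
`pullbackHom_app_unitSection`).  For `g : X ⟶ Y`, `h : X' ⟶ X` and a cocycle `c` on `Y`: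

* §1 cocycle bookkeeping: `ext'` (cocycles with the same opens and transition functions are equal),
  **`pullback_comp : c.pullback (h ≫ g) = (c.pullback g).pullback h`** (on the nose; `(h ≫ g)^♯ = h^♯ ∘ g^♯`, Mathlib
  `Scheme.Hom.appLE_comp_appLE`), `pullback_congr : g = g' → c.pullback g = c.pullback g'`; the identification
  `eqToHom : lineBundle c₁ ⟶ lineBundle c₂` of equal cocycles on sections (`comp_eqToHom_app`, cast-free) and on generators
  (`eqToHom_app_lineBundleGen`);
* §2 **`pullbackCongr_hom_comp_pullbackHom`** — along equal morphisms `g = g'`, Mathlib's `pullbackCongr` intertwines the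
  two natural maps up to that identification;
* §3 **`pullbackComp_inv_comp_pullbackHom`** — along a composite, `(h ≫ g)^*L ≅ h^*g^*L → h^*lineBundle (c.pullback g) →
  lineBundle ((c.pullback g).pullback h)` IS the natural map of `h ≫ g` followed by the identification (EGA 0_I (4.4.8),
  transitivity of inverse images; proof: both sides take the same values on the pulled-back sections `η(s)` —
  `h^♯(g^♯ s_{g(hx)}) = (h ≫ g)^♯ s_{g(hx)}` (`pullbackFlatFun_pullbackFlatFun`) — via ★ `unit_comp_map_pullbackComp_inv`);
* §4 **`pullback_map_pullbackLineBundleIso_inv_comp`** — for an endomorphism `a` of `X` over `g` (`a ≫ g = g`) the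
  canonical linearisation `a^*g^*L ≅ (a ≫ g)^*L = g^*L` transported through `pullbackLineBundleIso g c` is
  `pullbackLineBundleIso a (c.pullback g)` followed by the identification `(c.pullback g).pullback a = c.pullback g` (the
  shape in which group actions over `g` act on `lineBundle (c.pullback g)`, e.g. translations by `n`-torsion points over
  `[n]` in the Kummer-pairing computation (h9-S)).

Everything is proved; no definitions, no named facts, no instance, no `sorry`.  Cell `hodgecm-mathlib` (D-0151), (h9-S)
(W2-i) FILE 2; HC_CM is proved only modulo the 7 printed citations until rung 0 closes.

## References

* R. Hartshorne, *Algebraic Geometry*, GTM 52 (1977), II Ex. 6.8 (a) (p. 150), III Ex. 4.5 (p. 224). [Hartshorne1977]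
* A. Grothendieck, J. Dieudonné, *EGA I* (Springer 1971), 0, (4.4.3)–(4.4.8) (transitivity of inverse images). [folklore]
* The Stacks project, Tag 01CB (functoriality of sheaves of modules). [StacksProject]
-/

noncomputable section

-- `TopCat.Presheaf`/`Scheme.Modules` are not reducible (as in Mathlib's `AlgebraicGeometry/Modules/Sheaf.lean`).
set_option backward.isDefEq.respectTransparency false

open CategoryTheory AlgebraicGeometry Opposite TopologicalSpace Limits

namespace Literature.AlgebraicGeometry.Modules

open Literature.AlgebraicGeometry.Motives

universe u

variable {X Y : Scheme.{u}} (g : X ⟶ Y) (c : UnitCocycle Y)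

namespace UnitCocycle

/-! ### Compatibilities: equal cocycles, composites, equal morphisms -/

/-- Extensionality for cocycles: the same opens and the same transition functions.
[cite: Hartshorne1977, II Ex. 6.8 (a) and III Ex. 4.5] -/
theorem ext' {c₁ c₂ : UnitCocycle X} (hU : ∀ x, c₁.U x = c₂.U x)
    (hg : ∀ (x y : X) (V : X.Opens) (hx₁ : V ≤ c₁.U x) (hy₁ : V ≤ c₁.U y) (hx₂ : V ≤ c₂.U x)
      (hy₂ : V ≤ c₂.U y), c₁.g x y V hx₁ hy₁ = c₂.g x y V hx₂ hy₂) : c₁ = c₂ := by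
  obtain ⟨U₁, mem₁, g₁, map₁, mul₁, self₁⟩ := c₁
  obtain ⟨U₂, mem₂, g₂, map₂, mul₂, self₂⟩ := c₂
  obtain rfl : U₁ = U₂ := funext hU
  obtain rfl : g₁ = g₂ := by
    funext x y V hx hy
    exact hg x y V hx hy hx hy
  rfl

/-- **Pull-back of cocycles along a composite**: `c.pullback (h ≫ g) = (c.pullback g).pullback h` ON THE NOSE (the opens
`(h ≫ g)⁻¹U_{g(hx)} = h⁻¹g⁻¹U_{g(hx)}` agree definitionally, the transition functions by `h^♯ ∘ g^♯ = (h ≫ g)^♯`, Mathlib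
`Scheme.Hom.appLE_comp_appLE`). [cite: Hartshorne1977, II Ex. 6.8 (a) and III Ex. 4.5] -/
theorem pullback_comp {X' : Scheme.{u}} (h : X' ⟶ X) : c.pullback (h ≫ g) = (c.pullback g).pullback h := by
  refine ext' (fun x => rfl) fun x y V hx₁ hy₁ hx₂ hy₂ => ?_
  rw [pullback_g, pullback_g, pullback_g]
  change _ = (g.appLE _ _ _ ≫ h.appLE _ V _) _
  rw [Scheme.Hom.appLE_comp_appLE]
  rfl

/-- Pull-back of cocycles along equal morphisms. [cite: Hartshorne1977, II Ex. 6.8 (a) and III Ex. 4.5] -/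
theorem pullback_congr {g g' : X ⟶ Y} (hg : g = g') : c.pullback g = c.pullback g' := by
  subst hg
  rfl

/-- **Equal cocycles have equal glued line bundles; the sections of the identification `eqToHom`, cast-free**: the
`x`-component of the image of `s` is the `x`-component of `s` restricted along the equality of opens `V ⊓ U₂_x = V ⊓ U₁_x`.
[cite: Hartshorne1977, II Ex. 6.8 (a) and III Ex. 4.5] -/
theorem comp_eqToHom_app {c₁ c₂ : UnitCocycle X} (h : c₁ = c₂) (V : X.Opens) (s : Γ(lineBundle c₁, V)) (x : X) :
    c₂.comp ((eqToHom (congrArg lineBundle h) : lineBundle c₁ ⟶ lineBundle c₂).app V s) x =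
      secRes X (by rw [h]) (c₁.comp s x) := by
  subst h
  rw [secRes_self, eqToHom_refl, Scheme.Modules.Hom.id_app]
  rfl

/-- `(pullback h).map φ` sends `η_h(y)` to `η_h(φ y)` (naturality of the unit of `h^* ⊣ h_*`). [folklore] -/
private theorem pullback_map_app_unitSection' {X' : Scheme.{u}} (h : X' ⟶ X) {A B : X.Modules} (φ : A ⟶ B)
    (W : X.Opens) (y : Γ(A, W)) :
    ((Scheme.Modules.pullback h).map φ).app (h ⁻¹ᵁ W) (unitSection h A W y) = unitSection h B W (φ.app W y) := by
  have h1 := (Scheme.Modules.pullbackPushforwardAdjunction h).unit_naturality φ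
  have h2 := congrArg (fun ψ => (Scheme.Modules.Hom.app ψ W) y) h1
  simp only [Scheme.Modules.Hom.comp_app] at h2
  exact h2

/-- `pullbackComp⁻¹ : (h ≫ g)^*M → h^*g^*M` sends `η_{h≫g}(m)` to `η_h(η_g(m))` (★ `unit_comp_map_pullbackComp_inv` on
sections). [folklore] -/
private theorem pullbackComp_inv_app_unitSection' {X' : Scheme.{u}} (h : X' ⟶ X) (M : Y.Modules) (W : Y.Opens)
    (m : Γ(M, W)) :
    ((Scheme.Modules.pullbackComp h g).inv.app M).app ((h ≫ g) ⁻¹ᵁ W) (unitSection (h ≫ g) M W m) =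
      unitSection h ((Scheme.Modules.pullback g).obj M) (g ⁻¹ᵁ W) (unitSection g M W m) := by
  have h1 := unit_comp_map_pullbackComp_inv h g M
  have h2 := congrArg (fun φ => (Scheme.Modules.Hom.app φ W) m) h1
  simp only [Scheme.Modules.Hom.comp_app] at h2
  exact h2

/-- Morphisms out of `f^*E` are determined by their values on pulled-back sections `η(s)` (transposition under
`f^* ⊣ f_*`). [folklore] -/
private theorem hom_ext_unitSection' {X' : Scheme.{u}} (f : X' ⟶ Y) (E : Y.Modules) {N : X'.Modules}
    {α β : (Scheme.Modules.pullback f).obj E ⟶ N}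
    (hαβ : ∀ (W : Y.Opens) (s : Γ(E, W)),
      α.app (f ⁻¹ᵁ W) (unitSection f E W s) = β.app (f ⁻¹ᵁ W) (unitSection f E W s)) : α = β := by
  apply ((Scheme.Modules.pullbackPushforwardAdjunction f).homEquiv _ _).injective
  apply Scheme.Modules.hom_ext
  intro W
  ext s
  have hα := congrArg (fun φ => (Scheme.Modules.Hom.app φ W) s)
    ((Scheme.Modules.pullbackPushforwardAdjunction f).homEquiv_unit (X := E) (Y := N) (f := α))
  have hβ := congrArg (fun φ => (Scheme.Modules.Hom.app φ W) s)
    ((Scheme.Modules.pullbackPushforwardAdjunction f).homEquiv_unit (X := E) (Y := N) (f := β))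
  simp only [Scheme.Modules.Hom.comp_app] at hα hβ
  exact hα.trans ((hαβ W s).trans hβ.symm)

/-- The computation rule for `pullbackHom` followed by any morphism `ψ`: `(pullbackHom ≫ ψ)(η s) = ψ((g^♯ s_{g x})_x)`.
[cite: Hartshorne1977, II Ex. 6.8 (a) and III Ex. 4.5] -/
theorem pullbackHom_comp_app_unitSection {N : X.Modules} (ψ : lineBundle (c.pullback g) ⟶ N) (W : Y.Opens)
    (s : Γ(lineBundle c, W)) :
    (pullbackHom g c ≫ ψ).app (g ⁻¹ᵁ W) (unitSection g (lineBundle c) W s) = ψ.app (g ⁻¹ᵁ W) (pullbackFlatFun g c W s) := by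
  rw [Scheme.Modules.Hom.comp_app, CategoryTheory.comp_apply, pullbackHom_app_unitSection]

/-- **The pull-back maps along equal morphisms agree up to the identifications**: for `hg : g = g'`,
`pullbackCongr hg ≫ pullbackHom g' c = pullbackHom g c ≫ eqToHom _` (along `c.pullback g = c.pullback g'`).
[cite: Hartshorne1977, II Ex. 6.8 (a) and III Ex. 4.5] -/
theorem pullbackCongr_hom_comp_pullbackHom {g g' : X ⟶ Y} (hg : g = g') :
    (Scheme.Modules.pullbackCongr hg).hom.app (lineBundle c) ≫ pullbackHom g' c =
      pullbackHom g c ≫ eqToHom (congrArg lineBundle (pullback_congr c hg)) := by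
  subst hg
  simp [Scheme.Modules.pullbackCongr]

/-- Pulling back the components twice is pulling them back along the composite:
`h^♯(g^♯(s_{g(hx)})) = (h ≫ g)^♯(s_{g(hx)})` (Mathlib `Scheme.Hom.appLE_comp_appLE`).
[cite: Hartshorne1977, II Ex. 6.8 (a) and III Ex. 4.5] -/
theorem pullComp_pullbackFlatFun {X' : Scheme.{u}} (h : X' ⟶ X) (W : Y.Opens) (s : Γ(lineBundle c, W)) (x : X') :
    pullComp h (c.pullback g) (g ⁻¹ᵁ W) (pullbackFlatFun g c W s) x =
      (h ≫ g).appLE (W ⊓ c.U (g.base (h.base x))) (h ⁻¹ᵁ (g ⁻¹ᵁ W) ⊓ ((c.pullback g).pullback h).U x)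
        ((le_preimage_inf h inf_le_left inf_le_right).trans
          (h.preimage_mono (le_preimage_inf g inf_le_left inf_le_right)))
        (c.comp s (g.base (h.base x))) := by
  unfold pullComp
  rw [comp_pullbackFlatFun]
  unfold pullComp
  change (g.appLE _ _ _ ≫ h.appLE _ _ _) _ = _
  rw [Scheme.Hom.appLE_comp_appLE]

/-- The sections identity behind `pullbackComp_inv_comp_pullbackHom`: pulling back the family `(g^♯ s_{g x})_x` along
`h` gives the family `((h ≫ g)^♯ s_{(h ≫ g) x})_x`, transported along `c.pullback (h ≫ g) = (c.pullback g).pullback h`.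
[cite: Hartshorne1977, II Ex. 6.8 (a) and III Ex. 4.5] -/
theorem pullbackFlatFun_pullbackFlatFun {X' : Scheme.{u}} (h : X' ⟶ X) (W : Y.Opens) (s : Γ(lineBundle c, W)) :
    pullbackFlatFun h (c.pullback g) (g ⁻¹ᵁ W) (pullbackFlatFun g c W s) =
      (eqToHom (congrArg lineBundle (pullback_comp g c h)) :
          lineBundle (c.pullback (h ≫ g)) ⟶ lineBundle ((c.pullback g).pullback h)).app ((h ≫ g) ⁻¹ᵁ W)
        (pullbackFlatFun (h ≫ g) c W s) := by
  ext x
  refine Eq.trans ?_ (comp_eqToHom_app (pullback_comp g c h) _ _ x).symm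
  rw [comp_pullbackFlatFun, comp_pullbackFlatFun]
  exact (pullComp_pullbackFlatFun g c h W s x).trans (secRes_pullComp (h ≫ g) c W s x _).symm

/-- **The pull-back maps along a composite compose**: `(h ≫ g)^*L ≅ h^*g^*L → h^* lineBundle (c.pullback g) →
lineBundle ((c.pullback g).pullback h)` is `pullbackHom (h ≫ g) c` followed by the identification along
`c.pullback (h ≫ g) = (c.pullback g).pullback h` (compare the values on pulled-back sections `η(s)`: ★
`unit_comp_map_pullbackComp_inv` and `pullbackFlatFun_pullbackFlatFun`).
[cite: Hartshorne1977, II Ex. 6.8 (a) and III Ex. 4.5] -/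
theorem pullbackComp_inv_comp_pullbackHom {X' : Scheme.{u}} (h : X' ⟶ X) :
    (Scheme.Modules.pullbackComp h g).inv.app (lineBundle c) ≫ (Scheme.Modules.pullback h).map (pullbackHom g c) ≫
        pullbackHom h (c.pullback g) =
      pullbackHom (h ≫ g) c ≫ eqToHom (congrArg lineBundle (pullback_comp g c h)) := by
  refine hom_ext_unitSection' (h ≫ g) (lineBundle c) fun W s => ?_
  have lhs : ((Scheme.Modules.pullbackComp h g).inv.app (lineBundle c) ≫
      (Scheme.Modules.pullback h).map (pullbackHom g c) ≫ pullbackHom h (c.pullback g)).app ((h ≫ g) ⁻¹ᵁ W)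
        (unitSection (h ≫ g) (lineBundle c) W s) =
      pullbackFlatFun h (c.pullback g) (g ⁻¹ᵁ W) (pullbackFlatFun g c W s) := by
    rw [Scheme.Modules.Hom.comp_app, Scheme.Modules.Hom.comp_app, CategoryTheory.comp_apply,
      CategoryTheory.comp_apply, pullbackComp_inv_app_unitSection']
    change (pullbackHom h (c.pullback g)).app (h ⁻¹ᵁ (g ⁻¹ᵁ W))
        (((Scheme.Modules.pullback h).map (pullbackHom g c)).app (h ⁻¹ᵁ (g ⁻¹ᵁ W))
          (unitSection h ((Scheme.Modules.pullback g).obj (lineBundle c)) (g ⁻¹ᵁ W)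
            (unitSection g (lineBundle c) W s))) = _
    rw [pullback_map_app_unitSection', pullbackHom_app_unitSection, pullbackHom_app_unitSection]
  rw [lhs, pullbackHom_comp_app_unitSection, pullbackFlatFun_pullbackFlatFun]

/-- **The identification of equal glued line bundles on generators**: `eqToHom` maps `t_z` to `t_z`.
[cite: Hartshorne1977, II Ex. 6.8 (a) and III Ex. 4.5] -/
theorem eqToHom_app_lineBundleGen {c₁ c₂ : UnitCocycle X} (h : c₁ = c₂) (z : X) (V : X.Opens) (h₁ : V ≤ c₁.U z)
    (h₂ : V ≤ c₂.U z) :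
    (eqToHom (congrArg lineBundle h) : lineBundle c₁ ⟶ lineBundle c₂).app V (c₁.lineBundleGen z V h₁) =
      c₂.lineBundleGen z V h₂ := by
  subst h
  rw [eqToHom_refl, Scheme.Modules.Hom.id_app]
  rfl

/-- **An endomorphism `a` of `X` over `g` (`a ≫ g = g`) acts on `lineBundle (c.pullback g)` through the natural
isomorphisms**: the canonical linearisation `a^*g^*L ≅ (a ≫ g)^*L = g^*L` (Mathlib `pullbackComp ≫ pullbackCongr`)
transported through `pullbackLineBundleIso g c` on both sides is «`a^* lineBundle (c.pullback g) ≅ lineBundle ((c.pullback g).pullback a)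
= lineBundle (c.pullback g)`» — `pullbackLineBundleIso a (c.pullback g)` followed by the identification along the cocycle
equality `(c.pullback g).pullback a = c.pullback (a ≫ g) = c.pullback g` (the shape (N) consumed by the Kummer-pairing
computation of (h9-S)). [cite: Hartshorne1977, II Ex. 6.8 (a) and III Ex. 4.5] -/
theorem pullback_map_pullbackLineBundleIso_inv_comp {a : X ⟶ X} (ha : a ≫ g = g) :
    (Scheme.Modules.pullback a).map (pullbackLineBundleIso g c).inv ≫
        (Scheme.Modules.pullbackComp a g).hom.app (lineBundle c) ≫
        (Scheme.Modules.pullbackCongr ha).hom.app (lineBundle c) ≫ (pullbackLineBundleIso g c).hom =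
      (pullbackLineBundleIso a (c.pullback g)).hom ≫
        eqToHom (congrArg lineBundle ((pullback_comp g c a).symm.trans (pullback_congr c ha))) := by
  have H1 : pullbackHom (a ≫ g) c = ((Scheme.Modules.pullbackComp a g).inv.app (lineBundle c) ≫
      (Scheme.Modules.pullback a).map (pullbackHom g c) ≫ pullbackHom a (c.pullback g)) ≫
        eqToHom (congrArg lineBundle (pullback_comp g c a)).symm :=
    (comp_eqToHom_iff _ _ _).mp (pullbackComp_inv_comp_pullbackHom g c a).symm
  rw [pullbackLineBundleIso_hom, pullbackLineBundleIso_hom, pullbackCongr_hom_comp_pullbackHom c ha, H1]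
  simp only [Category.assoc, eqToHom_trans, Iso.hom_inv_id_app_assoc]
  rw [← Functor.map_comp_assoc, ← pullbackLineBundleIso_hom, Iso.inv_hom_id, CategoryTheory.Functor.map_id, Category.id_comp]

end UnitCocycle

end Literature.AlgebraicGeometry.Modules

end
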